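import Summits.QuantumFields.YangMills.Theorems.VirialFluxGapFixCoord
import Summits.QuantumFields.YangMills.Theorems.VirialFluxGapAnchorWindowDatum
import Summits.QuantumFields.YangMills.Theorems.VirialFluxGapProductSincWeight
import HarnessLib

/-!
# The `j`-window datum `hw` on the tree-gauged ring space `X_fix`
# (layer (B2) of the DIRECT Laplace road to ⟨stmt-QuantumFields-24204⟩ `VirialFluxGap.SharpTwistedLaplace`)

Helper module (free-hands work of width seat ym-line-sfw-p2-w3 g57, cell ym-idea-1; `--supports 24204`).  The density of the chart identity
✓`FixSplit.fix_hloc` is `J(z, y) = restWeight(b(y)) · anchorDensity(z, a(y))` (`(a(y), b(y)) = fixCoord y`).  Hypothesis `hw` of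
✓`laplaceMethod_quantitative_orbit_tube` asks for `∫_Φ J(z, y) dz = I₀ · (1 + ℓ(y) + e(y))` with `ℓ` odd, `|ℓ(y)| ≤ D‖y‖`, `|e(y)| ≤ G‖y‖²` on a
ball.  Here this is PROVED with constants `r₀, D, G, A₀` depending ONLY on the anchor data (not on `L`):
* `restWeight_fixCoord_eq` — `restWeight(b(y)) = (2π²)^{−N} · ∏_c sinc²‖b_c(y)‖`, `N = #components`;
* `abs_prod_sinc_sq_rest_sub_one_le` — `|∏_c sinc²‖b_c(y)‖ − 1| ≤ ‖y‖²/3` (✓`ChartWeight.abs_prod_sinc_sq_sub_one_le` + the block decomposition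
  ✓`norm_sq_eq_blocks`);
* ★★ `exists_fix_window_datum` — `∫_{B̄_{r₀}} J(z, y) dz = A₀ (2π²)^{−N} (1 + ℓ(y) + e(y))` for `‖y‖ ≤ r₀`, with `ℓ(y) = ℓ₁(a(y))` and the anchor datum
  ✓`AnchorSlice.exists_anchor_window_datum` (`A₀ = ∫_{B̄_{r₀}} anchorDensity(z, 0) dz > 0`), `G = G₁ + 1/3 + (D₁ + G₁)/3`.
So `w₀ = A₀ (2π²)^{−N} / ν((e(Φ)·S)⁻¹)` and `|log w₀| = O(N) = O(L⁴)` downstream.  Everything here is PROVED; no definitions, no named facts.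
HONEST FRAMING: calculus∕bookkeeping; ⟨24204⟩, ⟨24319⟩ and every rung stay OPEN; the Yang–Mills mass gap (Clay) is NOT touched; no summit is
proved by a line.

## References
* K. W. Breitung, *Asymptotic Approximations for Probability Integrals*, LNM 1592 (1994), Lemma 7 p. 12; §2.3; Thm 41 p. 56. [Breitung1994]
* T. Balaban, *Comm. Math. Phys.* 102 (1985) 255–275, p. 260. [Balaban1985UV3]
-/

set_option autoImplicit false

noncomputable section

open MeasureTheory Set Filter Metric WithLp
open scoped ENNReal RealInnerProductSpace
open Literature.MathematicalPhysics.QuantumLattice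
open Literature.MathematicalPhysics.QuantumFieldTheory hiding SU2
open Literature.MathematicalPhysics.QuantumFieldTheory.Balaban1983to89.T4HaarSU2ExpChart
open Literature.MathematicalPhysics.QuantumFieldTheory.Balaban1983to89.T4ExpWindowSmallField
open Summit.QuantumFields.YangMills.Theorems.FemtoTransferGap
open Summit.QuantumFields.YangMills.Theorems.FemtoTransferGap.TT
open Summit.QuantumFields.YangMills.Theorems.VirialFluxGap.AnchorSlice
open Summit.QuantumFields.YangMills.Theorems.VirialFluxGap.ChartWeight

namespace Summit.QuantumFields.YangMills.Theorems.VirialFluxGap.FixSplit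

variable {L : ℕ} [NeZero L] {e₀ : OffIdx L} {y₀ : Site 3 L}

/-! ## §1 The rest weight along the Euclidean model -/

/-- The seam∕link block is linear (odd) in `y`. [folklore] -/
theorem fixCoord_neg_fst (y : EuclideanSpace ℝ (Fin (fixDim L e₀ y₀))) : (fixCoord (-y)).1 = -(fixCoord y).1 := by
  ext m
  simp only [fixCoord_fst_apply, PiLp.neg_apply]

/-- **Product form of the rest weight**: `restWeight(b(y)) = (2π²)^{−N} ∏_c sinc²‖b_c(y)‖` over the component index
`I₁ ⊕ ((Fin (2L−1) × Edge) ⊕ I₃)`. [cite: Balaban1985UV3, p. 260] -/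
theorem restWeight_fixCoord_eq (y : EuclideanSpace ℝ (Fin (fixDim L e₀ y₀))) :
    restWeight (fixCoord y).2 = (2 * Real.pi ^ 2)⁻¹ ^ Fintype.card ({i : OffIdx L // ¬ i = e₀} ⊕ ((Fin (2 * L - 1) × Edge 3 L) ⊕ {y : Site 3 L // ¬ y = y₀})) *
      ∏ c : {i : OffIdx L // ¬ i = e₀} ⊕ ((Fin (2 * L - 1) × Edge 3 L) ⊕ {y : Site 3 L // ¬ y = y₀}),
        Real.sinc (Sum.elim (fun i => ‖(fixCoord y).2.1 i‖) (Sum.elim (fun je : Fin (2 * L - 1) × Edge 3 L => ‖(fixCoord y).2.2.1 je.1 je.2‖)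
          (fun s => ‖(fixCoord y).2.2.2 s‖)) c) ^ 2 := by
  have hprod : restWeight (fixCoord y).2 = ∏ c : {i : OffIdx L // ¬ i = e₀} ⊕ ((Fin (2 * L - 1) × Edge 3 L) ⊕ {y : Site 3 L // ¬ y = y₀}),
      expWeight (Sum.elim (fun i => (fixCoord y).2.1 i) (Sum.elim (fun je : Fin (2 * L - 1) × Edge 3 L => (fixCoord y).2.2.1 je.1 je.2)
        (fun s => (fixCoord y).2.2.2 s)) c) := by
    rw [restWeight, Fintype.prod_sum_type, Fintype.prod_sum_type, Fintype.prod_prod_type]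
    rfl
  rw [hprod, ← Finset.card_univ, ← Finset.prod_const, ← Finset.prod_mul_distrib]
  refine Finset.prod_congr rfl fun c _ => ?_
  rcases c with i | je | s <;> simp only [Sum.elim_inl, Sum.elim_inr, expWeight]

/-- The sum of the squared rest norms is at most `‖y‖²`. [folklore] -/
theorem sum_rest_norm_sq_le (y : EuclideanSpace ℝ (Fin (fixDim L e₀ y₀))) :
    ∑ c : {i : OffIdx L // ¬ i = e₀} ⊕ ((Fin (2 * L - 1) × Edge 3 L) ⊕ {y : Site 3 L // ¬ y = y₀}),
        Sum.elim (fun i => ‖(fixCoord y).2.1 i‖) (Sum.elim (fun je : Fin (2 * L - 1) × Edge 3 L => ‖(fixCoord y).2.2.1 je.1 je.2‖)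
          (fun s => ‖(fixCoord y).2.2.2 s‖)) c ^ 2 ≤ ‖y‖ ^ 2 := by
  rw [Fintype.sum_sum_type, Fintype.sum_sum_type, norm_sq_eq_blocks y]
  simp only [Sum.elim_inl, Sum.elim_inr]
  linarith [sq_nonneg ‖(fixCoord y).1‖]

/-- ★ `|∏_c sinc²‖b_c(y)‖ − 1| ≤ ‖y‖²/3`. [cite: Breitung1994, Lemma 7 p. 12] [cite: Balaban1985UV3, p. 260] -/
theorem abs_prod_sinc_sq_rest_sub_one_le (y : EuclideanSpace ℝ (Fin (fixDim L e₀ y₀))) :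
    |(∏ c : {i : OffIdx L // ¬ i = e₀} ⊕ ((Fin (2 * L - 1) × Edge 3 L) ⊕ {y : Site 3 L // ¬ y = y₀}),
        Real.sinc (Sum.elim (fun i => ‖(fixCoord y).2.1 i‖) (Sum.elim (fun je : Fin (2 * L - 1) × Edge 3 L => ‖(fixCoord y).2.2.1 je.1 je.2‖)
          (fun s => ‖(fixCoord y).2.2.2 s‖)) c) ^ 2) - 1| ≤ ‖y‖ ^ 2 / 3 := by
  refine (abs_prod_sinc_sq_sub_one_le _ _).trans ?_
  exact div_le_div_of_nonneg_right (sum_rest_norm_sq_le y) (by norm_num)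

/-- The product of `sinc²` of the rest norms is measurable in `y`. [folklore] -/
theorem measurable_prod_sinc_sq_rest :
    Measurable fun y : EuclideanSpace ℝ (Fin (fixDim L e₀ y₀)) =>
      ∏ c : {i : OffIdx L // ¬ i = e₀} ⊕ ((Fin (2 * L - 1) × Edge 3 L) ⊕ {y : Site 3 L // ¬ y = y₀}),
        Real.sinc (Sum.elim (fun i => ‖(fixCoord y).2.1 i‖) (Sum.elim (fun je : Fin (2 * L - 1) × Edge 3 L => ‖(fixCoord y).2.2.1 je.1 je.2‖)
          (fun s => ‖(fixCoord y).2.2.2 s‖)) c) ^ 2 := by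
  refine Finset.measurable_prod _ fun c _ => ?_
  rcases c with i | je | s
  · simp only [Sum.elim_inl]
    exact (Real.continuous_sinc.measurable.comp ((continuous_apply i).comp (continuous_fst.comp
      (continuous_snd.comp continuous_fixCoord))).norm.measurable).pow_const 2
  · simp only [Sum.elim_inr, Sum.elim_inl]
    exact (Real.continuous_sinc.measurable.comp ((continuous_apply je.2).comp ((continuous_apply je.1).comp (continuous_fst.comp
      (continuous_snd.comp (continuous_snd.comp continuous_fixCoord))))).norm.measurable).pow_const 2
  · simp only [Sum.elim_inr]
    exact (Real.continuous_sinc.measurable.comp ((continuous_apply s).comp (continuous_snd.comp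
      (continuous_snd.comp (continuous_snd.comp continuous_fixCoord)))).norm.measurable).pow_const 2

/-! ## §2 The window datum -/

/-- ★★ **THE `j`-WINDOW DATUM ON `X_fix`** (hypothesis `hw` of ✓`laplaceMethod_quantitative_orbit_tube`, amplitude `φ = 1`), with constants
depending only on the anchor data: there are `0 < r₀ < 1`, `D, G ≥ 0`, `A₀ > 0` such that for every `L, e₀, y₀` there are measurable
`ℓ` (odd) and `e` on `V = ℝ^{fixDim}` with `|ℓ(y)| ≤ D‖y‖`, `|e(y)| ≤ G‖y‖²` and
`∫_{B̄_{r₀}} restWeight(b(y)) · anchorDensity(z, a(y)) dz = A₀ (2π²)^{−N} (1 + ℓ(y) + e(y))` for `‖y‖ ≤ r₀`.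
[cite: Breitung1994, §2.3; Lemma 7 p. 12; Thm 41 p. 56] [cite: Balaban1985UV3, p. 260] -/
theorem exists_fix_window_datum {ωC ωN ωX : EuclideanSpace ℝ (Fin 3)} {C₀ N₀ : SU2} (hC : ‖ωC‖ = 1) (hN : ‖ωN‖ = 1)
    (hCN : ⟪ωC, ωN⟫ = 0) (hX : imQuat ωX = imQuat ωC * imQuat ωN) (hC₀ : su2Quat C₀ = imQuat ωC)
    (hN₀ : su2Quat N₀ = imQuat ωN ∨ su2Quat N₀ = -imQuat ωN) :
    ∃ r₀ : ℝ, 0 < r₀ ∧ r₀ < 1 ∧ ∃ D G A₀ : ℝ, 0 ≤ D ∧ 0 ≤ G ∧ 0 < A₀ ∧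
      A₀ = ∫ z in closedBall (0 : EuclideanSpace ℝ (Fin 3)) r₀, anchorDensity ωC ωN ωX C₀ N₀ (z, 0) ∧
      ∀ (L : ℕ) [NeZero L] (e₀ : OffIdx L) (y₀ : Site 3 L),
        ∃ ll ee : EuclideanSpace ℝ (Fin (fixDim L e₀ y₀)) → ℝ, Measurable ll ∧ Measurable ee ∧ (∀ y, ll (-y) = -ll y) ∧
          (∀ y, ‖y‖ ≤ r₀ → |ll y| ≤ D * ‖y‖) ∧ (∀ y, ‖y‖ ≤ r₀ → |ee y| ≤ G * ‖y‖ ^ 2) ∧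
          ∀ y, ‖y‖ ≤ r₀ →
            ∫ z in closedBall (0 : EuclideanSpace ℝ (Fin 3)) r₀, restWeight (fixCoord y).2 * anchorDensity ωC ωN ωX C₀ N₀ (z, (fixCoord y).1) =
              A₀ * (2 * Real.pi ^ 2)⁻¹ ^ Fintype.card ({i : OffIdx L // ¬ i = e₀} ⊕ ((Fin (2 * L - 1) × Edge 3 L) ⊕ {y : Site 3 L // ¬ y = y₀})) *
                (1 + ll y + ee y) := by
  obtain ⟨r₀, hr₀, hr₀1, D', G', hD', hG', hA₀, ll₁, ee₁, hll₁m, hee₁m, hodd, hll₁, hee₁, hI⟩ :=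
    exists_anchor_window_datum hC hN hCN hX hC₀ hN₀
  refine ⟨r₀, hr₀, hr₀1, D', G' + 1 / 3 + (D' + G') / 3, _, hD', by positivity, hA₀, rfl, fun L _ e₀ y₀ => ?_⟩
  set A₀ := ∫ z in closedBall (0 : EuclideanSpace ℝ (Fin 3)) r₀, anchorDensity ωC ωN ωX C₀ N₀ (z, 0) with hA₀def
  -- the rest factor `θ(y) = ∏ sinc² − 1`
  set θ : EuclideanSpace ℝ (Fin (fixDim L e₀ y₀)) → ℝ := fun y =>
    (∏ c : {i : OffIdx L // ¬ i = e₀} ⊕ ((Fin (2 * L - 1) × Edge 3 L) ⊕ {y : Site 3 L // ¬ y = y₀}),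
      Real.sinc (Sum.elim (fun i => ‖(fixCoord y).2.1 i‖) (Sum.elim (fun je : Fin (2 * L - 1) × Edge 3 L => ‖(fixCoord y).2.2.1 je.1 je.2‖)
        (fun s => ‖(fixCoord y).2.2.2 s‖)) c) ^ 2) - 1 with hθ
  have hθm : Measurable θ := measurable_prod_sinc_sq_rest.sub measurable_const
  have hθb : ∀ y : EuclideanSpace ℝ (Fin (fixDim L e₀ y₀)), |θ y| ≤ ‖y‖ ^ 2 / 3 := fun y => abs_prod_sinc_sq_rest_sub_one_le y
  have ham : Measurable fun y : EuclideanSpace ℝ (Fin (fixDim L e₀ y₀)) => (fixCoord y).1 := measurable_fst.comp measurable_fixCoord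
  refine ⟨fun y => ll₁ (fixCoord y).1, fun y => ee₁ (fixCoord y).1 + θ y + (ll₁ (fixCoord y).1 + ee₁ (fixCoord y).1) * θ y,
    hll₁m.comp ham, ((hee₁m.comp ham).add hθm).add (((hll₁m.comp ham).add (hee₁m.comp ham)).mul hθm), fun y => ?_, fun y hy => ?_,
    fun y hy => ?_, fun y hy => ?_⟩
  · show ll₁ (fixCoord (-y)).1 = -ll₁ (fixCoord y).1
    rw [fixCoord_neg_fst, hodd]
  · have ha : ‖(fixCoord y).1‖ ≤ ‖y‖ := norm_fixCoord_fst_le y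
    exact (hll₁ _ (ha.trans hy)).trans (mul_le_mul_of_nonneg_left ha hD')
  · have ha : ‖(fixCoord y).1‖ ≤ ‖y‖ := norm_fixCoord_fst_le y
    have ha' : ‖(fixCoord y).1‖ ≤ r₀ := ha.trans hy
    have hy1 : ‖y‖ ≤ 1 := hy.trans hr₀1.le
    have h1 := hll₁ _ ha'
    have h2 := hee₁ _ ha'
    have h3 := hθb y
    have hy0 := norm_nonneg y
    have ha0 := norm_nonneg (fixCoord y).1
    have hasq : ‖(fixCoord y).1‖ ^ 2 ≤ ‖y‖ ^ 2 := pow_le_pow_left₀ ha0 ha 2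
    have hysq1 : ‖y‖ ^ 2 ≤ 1 := by nlinarith
    have e1 : |ee₁ (fixCoord y).1| ≤ G' * ‖y‖ ^ 2 := h2.trans (mul_le_mul_of_nonneg_left hasq hG')
    have e2 : |ll₁ (fixCoord y).1 + ee₁ (fixCoord y).1| ≤ D' + G' := by
      refine (abs_add_le _ _).trans (add_le_add ?_ ?_)
      · exact h1.trans (by nlinarith)
      · exact e1.trans (by nlinarith)
    have e3 : |(ll₁ (fixCoord y).1 + ee₁ (fixCoord y).1) * θ y| ≤ (D' + G') * (‖y‖ ^ 2 / 3) := by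
      rw [abs_mul]
      exact mul_le_mul e2 h3 (abs_nonneg _) (by linarith)
    calc |ee₁ (fixCoord y).1 + θ y + (ll₁ (fixCoord y).1 + ee₁ (fixCoord y).1) * θ y|
        ≤ |ee₁ (fixCoord y).1| + |θ y| + |(ll₁ (fixCoord y).1 + ee₁ (fixCoord y).1) * θ y| := by
          refine (abs_add_le _ _).trans (add_le_add (abs_add_le _ _) le_rfl)
      _ ≤ G' * ‖y‖ ^ 2 + ‖y‖ ^ 2 / 3 + (D' + G') * (‖y‖ ^ 2 / 3) := add_le_add (add_le_add e1 h3) e3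
      _ = (G' + 1 / 3 + (D' + G') / 3) * ‖y‖ ^ 2 := by ring
  · have ha : ‖(fixCoord y).1‖ ≤ r₀ := (norm_fixCoord_fst_le y).trans hy
    rw [integral_const_mul, hI _ ha, restWeight_fixCoord_eq]
    simp only [hθ]
    ring

end Summit.QuantumFields.YangMills.Theorems.VirialFluxGap.FixSplit

end
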